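import Literature.NumberTheory.Automorphic.IdeleClassGroupAutomorphicQuotientProofs
import Literature.NumberTheory.Automorphic.IdeleClassGroupCompactProofs
import HarnessLib

/-!
# The automorphic quotient of `GL₁` is compact — discharge of
`AdelicGroupData.compactSpace_automorphicQuotient_gl_one`

Second sibling proof file of `Literature.NumberTheory.Automorphic.AdelicGroupData` (after
`AdelicGroupDataGLnProofs`), discharging the named fact

* `AdelicGroupData.compactSpace_automorphicQuotient_gl_one K :
    CompactSpace (AdelicGroupData.gl 1 K).automorphicQuotient` — **the automorphic quotient
  `GL₁(𝔸_K) ⧸ (A_G · GL₁(K))`, `A_G = ℝ_{>0}` the positive real scalars at the archimedean places,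
  is compact**,

as `AdelicGroupData.compactSpace_automorphicQuotient_gl_one_holds` (theorems only, no new
definitions).

## Source

A. Borel, *Some finiteness properties of adele groups over number fields*, Publ. Math. IHÉS 16
(1963) 5–30, §5, Theorem 5.8 (p. 22):

> 5.8. THEOREM. — Let `G` be connected. Then `ᵐG_A = ∩_{χ ∈ X_k(G)} ker(m_k ∘ χ_A)` is
> unimodular, contains `G_k`, the space `ᵐG_A/G_k` has a finite invariant measure, and `ᵐG_A/G_k`
> is compact if and only if every unipotent element of `G_k` belongs to the radical of `G_k`.
>
> A classical special case of 5.8 not included in 5.6 is the compactness of the quotient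
> `I_k¹/k*` of the group of ideles of `k` of idele-module one, by `k*`.

(`m_k : I_k → ℝ_+*` is the idele module, 5.7.)  For `G = GL₁` the group `ᵐG_A` is the group
`𝕀_K¹` of norm-one ideles, `G_k = Kˣ` has no non-trivial unipotent element, and 5.8 is the
compactness of `C_K¹ = 𝕀_K¹/Kˣ` (also Weil, *Basic Number Theory*, Ch. IV §4, Thm. 6;
Cassels–Fröhlich, Ch. II §16, Theorem).  The vendored fact divides instead by `A_G · GL₁(K)` with
`A_G = ρ(ℝ_{>0})`, `ρ = posRealIdele K` the diagonal archimedean embedding (design D10 of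
`AdelicGroupData`); by Weil's splitting `𝕀_K = 𝕀_K¹ × ρ(ℝ_{>0})` (Ch. IV §4, Cor. 2 of Thm. 5,
`|ρ(λ)|_𝔸 = λ^{[K:ℚ]}`) the two quotients are homeomorphic, `𝕀_K ⧸ (ρ(ℝ_{>0}) · Kˣ) ≃ₜ 𝕀_K¹/Kˣ`,
which is the discharged fact `IdeleClassGroup.nonempty_homeomorph_automorphicQuotient_normOne`.
So the fact is stated faithfully; no discrepancy with the source.

## Proof architecture

1. `AdelicGroupData.compactSpace_automorphicQuotient_gl1` — the automorphic quotient of the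
   *idelic* datum `AdelicGroupData.gl1 K` (`Adelic = 𝔸_Kˣ`), i.e. `𝕀_K ⧸ (ρ(ℝ_{>0}) · Kˣ)`, is
   compact: it is homeomorphic to `C_K¹`
   (`IdeleClassGroup.nonempty_homeomorph_automorphicQuotient_normOne_holds`, file
   `IdeleClassGroupAutomorphicQuotientProofs`) and `C_K¹` is compact
   (`IdeleClassGroup.isCompact_normOne_holds`, file `IdeleClassGroupCompactProofs`, ultimately
   `NormOneIdeleClassCompact`: finiteness of the class number and Dirichlet's unit theorem,
   Cassels–Fröhlich II §§16–18).
2. Transport to the *matrix* datum `AdelicGroupData.gl 1 K` (`Adelic = GL₁(𝔸_K) = M₁(𝔸_K)ˣ`):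
   the scalar embedding `s = Matrix.GeneralLinearGroup.scalar (Fin 1) : 𝔸_Kˣ →* GL₁(𝔸_K)` is
   continuous (`continuous_generalLinearGroup_scalar`) and surjective (a `1 × 1` invertible matrix
   is the scalar matrix of its determinant, `generalLinearGroup_scalar_det_of_fin_one`); it maps
   `ρ(ℝ_{>0})` onto `A_G = posRealScalar 1 K (ℝ_{>0})` (by the very definition of `posRealScalar`)
   and `Kˣ` into `GL₁(K)` (Mathlib `Matrix.GeneralLinearGroup.map_scalar`), so it descends to a
   continuous surjection `𝕀_K ⧸ (ρ(ℝ_{>0}) · Kˣ) → GL₁(𝔸_K) ⧸ (A_G · GL₁(K))`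
   (universal property of Mathlib's quotient map `QuotientGroup.isQuotientMap_mk`), and the
   continuous image of a compact space is compact (Mathlib `Function.Surjective.compactSpace`).

## References

* A. Borel, *Some finiteness properties of adele groups over number fields*, Publ. Math. IHÉS 16
  (1963), §5, Thm. 5.8 and the remark following it, p. 22 [Borel1963].
* A. Weil, *Basic Number Theory*, Grundlehren 144, Springer (1967), Ch. IV §4, Cor. 2 of Thm. 5
  and Thm. 6, p. 76 [WeilBNT1967].
* J. W. S. Cassels, A. Fröhlich (eds.), *Algebraic Number Theory* (1967), Ch. II §16, Theorem
  [CasselsFrohlichANT1967].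
-/

noncomputable section

open scoped NNReal
open NumberField IsDedekindDomain

namespace Literature.NumberTheory.Automorphic

/-! ### Scalar matrices: continuity, and `GL₁ = scalars` -/

section Scalar

/-- For a topological semiring `R` (only the topology is used), the scalar embedding
`Rˣ →* GL_n(R)`, `u ↦ u · 1`, is continuous for the units topologies (it is `Units.map` of the
continuous ring homomorphism `Matrix.scalar n : R →+* M_n(R)`; both `u ↦ u · 1` and
`u ↦ u⁻¹ · 1` are continuous into `M_n(R)`, Mathlib `Units.continuous_iff`). [folklore] -/
theorem continuous_generalLinearGroup_scalar {R : Type*} [Semiring R] [TopologicalSpace R]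
    (n : Type*) [DecidableEq n] [Fintype n] :
    Continuous (Matrix.GeneralLinearGroup.scalar n : Rˣ → GL n R) := by
  have h : Continuous fun a : R => Matrix.diagonal fun _ : n => a :=
    (continuous_pi fun _ => continuous_id).matrix_diagonal
  refine Units.continuous_iff.mpr ⟨?_, ?_⟩
  · exact (h.comp Units.continuous_val).congr fun _ => rfl
  · exact (h.comp Units.continuous_coe_inv).congr fun _ => rfl

/-- A `1 × 1` invertible matrix is the scalar matrix of its determinant:
`scalar (det g) = g` in `GL_1(R)` (`det g = g₀₀`, Mathlib `Matrix.det_fin_one`). [folklore] -/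
theorem generalLinearGroup_scalar_det_of_fin_one {R : Type*} [CommRing R] (g : GL (Fin 1) R) :
    Matrix.GeneralLinearGroup.scalar (Fin 1) (Matrix.GeneralLinearGroup.det g) = g := by
  refine Matrix.GeneralLinearGroup.ext fun i j => ?_
  rw [Subsingleton.elim i 0, Subsingleton.elim j 0]
  simp only [Matrix.GeneralLinearGroup.coe_scalar, Matrix.scalar_apply, Matrix.diagonal_apply_eq,
    Matrix.GeneralLinearGroup.val_det_apply, Matrix.det_fin_one]

/-- The scalar embedding `Rˣ → GL_1(R)` is surjective (`GL₁ = 𝔾ₘ` on points). [folklore] -/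
theorem generalLinearGroup_scalar_surjective_of_fin_one {R : Type*} [CommRing R] :
    Function.Surjective (Matrix.GeneralLinearGroup.scalar (Fin 1) : Rˣ → GL (Fin 1) R) :=
  fun g => ⟨Matrix.GeneralLinearGroup.det g, generalLinearGroup_scalar_det_of_fin_one g⟩

end Scalar

/-! ### From the idelic datum `gl1` to the matrix datum `gl 1` -/

namespace AdelicGroupData

variable (K : Type) [Field K] [NumberField K]

/-- **`𝕀_K ⧸ (ρ(ℝ_{>0}) · Kˣ)` is compact**: the automorphic quotient of the idelic datum
`AdelicGroupData.gl1 K` is homeomorphic to the norm-one idele class group `C_K¹ = 𝕀_K¹/Kˣ`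
(`IdeleClassGroup.nonempty_homeomorph_automorphicQuotient_normOne_holds`; Weil, *Basic Number
Theory*, Ch. IV §4, Cor. 2 of Thm. 5 and Thm. 6), which is compact
(`IdeleClassGroup.isCompact_normOne_holds`; Borel (1963), §5, remark after Thm. 5.8: "the
compactness of the quotient `I_k¹/k*`"; Weil, Ch. IV §4, Thm. 6). [cite: Borel1963, §5 Thm. 5.8] -/
theorem compactSpace_automorphicQuotient_gl1 : CompactSpace (gl1 K).automorphicQuotient := by
  obtain ⟨e⟩ : Nonempty ((gl1 K).automorphicQuotient ≃ₜ IdeleClassGroup.normOne K) :=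
    IdeleClassGroup.nonempty_homeomorph_automorphicQuotient_normOne_holds K
  have hc : IsCompact (IdeleClassGroup.normOne K : Set (IdeleClassGroup K)) :=
    IdeleClassGroup.isCompact_normOne_holds K
  haveI : CompactSpace (IdeleClassGroup.normOne K) := isCompact_iff_compactSpace.mp hc
  exact e.symm.compactSpace

/-- The scalar embedding `s : 𝔸_Kˣ →* GL_1(𝔸_K)` maps the subgroup `ρ(ℝ_{>0}) · Kˣ` divided out in
the automorphic quotient of `gl1 K` into the subgroup `A_G · GL_1(K)` divided out in that of
`gl 1 K`: `s ∘ ρ = posRealScalar 1 K` by definition, and `s(Kˣ) ⊆ GL_1(K)` since a scalar matrix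
with rational entry is rational (Mathlib `Matrix.GeneralLinearGroup.map_scalar`). [folklore] -/
theorem scalar_mem_quotientSubgroup_gl_one {x : (AdeleRing (𝓞 K) K)ˣ}
    (hx : x ∈ (gl1 K).quotientSubgroup) :
    Matrix.GeneralLinearGroup.scalar (Fin 1) x ∈ (gl 1 K).quotientSubgroup := by
  change x ∈ (posRealIdele K).range ⊔ (gl1 K).arithmeticSubgroup at hx
  change Matrix.GeneralLinearGroup.scalar (Fin 1) x ∈
    (posRealScalar 1 K).range ⊔ (gl 1 K).arithmeticSubgroup
  obtain ⟨_, ⟨t, rfl⟩, _, ⟨u, rfl⟩, rfl⟩ := Subgroup.mem_sup.mp hx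
  rw [map_mul]
  refine Subgroup.mul_mem _ (Subgroup.mem_sup_left ⟨t, rfl⟩) (Subgroup.mem_sup_right ?_)
  refine ⟨Matrix.GeneralLinearGroup.scalar (Fin 1) u, ?_⟩
  change Matrix.GeneralLinearGroup.map (algebraMap K (AdeleRing (𝓞 K) K))
      (Matrix.GeneralLinearGroup.scalar (Fin 1) u) =
    Matrix.GeneralLinearGroup.scalar (Fin 1)
      (Units.map (algebraMap K (AdeleRing (𝓞 K) K)).toMonoidHom u)
  rw [Matrix.GeneralLinearGroup.map_scalar]
  rfl

/-- **The automorphic quotient `GL_1(𝔸_K) ⧸ (A_G · GL_1(K))` is compact** (discharge of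
`AdelicGroupData.compactSpace_automorphicQuotient_gl_one`).  Borel, *Some finiteness properties of
adele groups over number fields* (1963), §5, Thm. 5.8 for `G = GL₁` (p. 22: "A classical special
case of 5.8 … is the compactness of the quotient `I_k¹/k*` of the group of ideles of `k` of
idele-module one, by `k*`"), combined with the splitting `I_k = I_k¹ × ℝ_{>0}` (Weil, *Basic
Number Theory*, Ch. IV §4, Cor. 2 of Thm. 5).  Proof: the compact space `𝕀_K ⧸ (ρ(ℝ_{>0}) · Kˣ)`
(`compactSpace_automorphicQuotient_gl1`) surjects continuously onto it through the map induced by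
the continuous surjection `scalar (Fin 1) : 𝔸_Kˣ → GL_1(𝔸_K)`
(`scalar_mem_quotientSubgroup_gl_one`, Mathlib `QuotientGroup.isQuotientMap_mk`,
`Function.Surjective.compactSpace`). [cite: Borel1963, §5 Thm. 5.8] -/
theorem compactSpace_automorphicQuotient_gl_one_holds :
    compactSpace_automorphicQuotient_gl_one K := by
  haveI : CompactSpace (gl1 K).automorphicQuotient := compactSpace_automorphicQuotient_gl1 K
  -- the scalar map `x ↦ [scalar x]`, constant on the cosets of `ρ(ℝ_{>0}) · Kˣ`
  let f : (AdeleRing (𝓞 K) K)ˣ → (gl 1 K).automorphicQuotient := fun x =>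
    (QuotientGroup.mk (Matrix.GeneralLinearGroup.scalar (Fin 1) x) : (gl 1 K).automorphicQuotient)
  have hf : ∀ x : (AdeleRing (𝓞 K) K)ˣ, f x =
      (QuotientGroup.mk (Matrix.GeneralLinearGroup.scalar (Fin 1) x) :
        (gl 1 K).automorphicQuotient) := fun x => rfl
  have hf_cont : Continuous f :=
    QuotientGroup.continuous_mk.comp (continuous_generalLinearGroup_scalar (Fin 1))
  have hf_eq : ∀ a b : (AdeleRing (𝓞 K) K)ˣ, a⁻¹ * b ∈ (gl1 K).quotientSubgroup → f a = f b := by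
    intro a b hab
    rw [hf, hf]
    refine QuotientGroup.eq.mpr ?_
    have h := scalar_mem_quotientSubgroup_gl_one K hab
    rwa [map_mul, map_inv] at h
  -- the descended map `φ : 𝕀_K ⧸ (ρ(ℝ_{>0}) · Kˣ) → GL_1(𝔸_K) ⧸ (A_G · GL_1(K))`
  let φ : (gl1 K).automorphicQuotient → (gl 1 K).automorphicQuotient := fun q =>
    Quotient.liftOn' q f fun a b hab => hf_eq a b (QuotientGroup.leftRel_apply.mp hab)
  have hφ : ∀ x : (AdeleRing (𝓞 K) K)ˣ,
      φ (QuotientGroup.mk x : (gl1 K).automorphicQuotient) = f x := fun x => rfl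
  have hφ_cont : Continuous φ :=
    (QuotientGroup.isQuotientMap_mk (gl1 K).quotientSubgroup).continuous_iff.mpr
      (hf_cont.congr fun x => (hφ x).symm)
  have hφ_surj : Function.Surjective φ := by
    intro q
    obtain ⟨g, rfl⟩ := QuotientGroup.mk_surjective q
    obtain ⟨x, rfl⟩ := generalLinearGroup_scalar_surjective_of_fin_one g
    exact ⟨QuotientGroup.mk x, hφ x⟩
  show CompactSpace (gl 1 K).automorphicQuotient
  exact hφ_surj.compactSpace hφ_cont

end AdelicGroupData

end Literature.NumberTheory.Automorphic
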